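import Summits.CriticalPhenomena.PercolationContinuityZ3.Theorems.Transplant.CayleyClassThreeWords
import Summits.CriticalPhenomena.PercolationContinuityZ3.Theorems.Transplant.CayleySkeletonConn
import Summits.CriticalPhenomena.PercolationContinuityZ3.Theorems.Transplant.CayleyFreeNilpotentClass
import HarnessLib

/-!
# Connected unit cylinders for LETTERS-ONLY nilpotent groups of class `≤ 3`; the free nilpotent groups `N_{m+2,3}`

builds on p205010 (kernel theorem, internal audit signed; external expert review pending).
Lane `prim-bschramm`, seat `prim-bschramm-p4` gen 11 (PART C3 of `P4-GENERAL.md`, "thick frames").  Helper file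
(`--supports stmt-CriticalPhenomena-4575 --as helper`).

The connected-cylinder criterion of `CayleySign₂` (file `CayleySkeletonConn`) asks that the cylinder `‖φ‖_∞ ≤ 1` of `Cay(Γ;S)` be connected.
THEOREM (`CylBase.boxWalks_of_classThree`): if `Γ` has class `≤ 3` (`γ₃(Γ) = 1`), `S` is a symmetric generating set all of whose letters
are kernel letters or `s₀^{±1}, s₁^{±1}`, then every `k ∈ ker φ` is joined to `1` inside `‖φ‖_∞ ≤ 1` — so `C_1` is connected.  Proof: by the
kernel criterion (`KerGen.mem_closure_of_eq_zero`) `ker φ` is generated by kernel letters and left-normed commutators `⁅a,b⁆`, `⁅a,⁅b,c⁆⁆`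
(weights `≥ 4` vanish); `⁅a,b⁆` has the 4-step word; for weight 3 the word of `⁅a⁻¹,⁅b,c⁆⁆` stays in the unit box when `φa, φb, φc` lie
in the positive quadrant `{0, e₀, e₁}` (file `CayleyClassThreeWords`), and every `⁅a,⁅b,c⁆⁆` is reduced to such one up to inversion and
conjugation by the class-3 identities.  CUSTOMER: **`FreeNilThree.theta_eq_zero_of_le` — `θ_g(p) = 0` for all `p ≤ p_c` on the
letters-only Cayley graph of the free nilpotent group `N_{m+2,3}` of class THREE, every rank `≥ 2`** (unconditional; class 2 was
`FreeNilLetters.fn_criticalContinuity`; for class `≥ 4` the letters-only `C_1` is disconnected — `P4-GENERAL.md` §33).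
-/

noncomputable section

namespace Summit.CriticalPhenomena.PercolationContinuityZ3.Theorems.Transplant

open SimpleGraph Walk Literature.Probability.LatticeModels Literature.Probability.Percolation
open scoped Classical commutatorElement

namespace CayCyl

variable {Γ : Type} [Group Γ] {S : Finset Γ}

namespace CylBase

variable (B : CylBase Γ S)

/-! ## §3 Connected unit cylinder in class `≤ 3` -/

/-- **THEOREM: in class `≤ 3`, with letters = kernel letters and `s₀^{±1}, s₁^{±1}`, every kernel element is joined to `1` inside the unit
cylinder `‖φ‖_∞ ≤ 1`** (hence `C_1`, and every `C_ℓ`, is connected). [folklore] -/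
theorem boxWalks_of_classThree (h3 : (⊤ : Subgroup Γ).lowerCentralSeries 3 = ⊥) (hS : Subgroup.closure (S : Set Γ) = ⊤)
    (hsymm : ∀ s ∈ S, s⁻¹ ∈ S) (hSφ : ∀ s ∈ S, B.φ s = 0 ∨ s = B.s₀ ∨ s = B.s₀⁻¹ ∨ s = B.s₁ ∨ s = B.s₁⁻¹) (k : Γ) (hk : B.φ k = 0) :
    ∃ w : (mulCayley (S : Set Γ)).Walk (1 : Γ) k, B.InBox 1 w := by
  -- kernel letters and `W A k` membership facts
  have hs0 : B.φ B.s₀ = Pi.single 0 1 := B.φ_s₀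
  have hs1 : B.φ B.s₁ = Pi.single 1 1 := B.φ_s₁
  have nn0 : NN (0 : Site 2) := fun i => by simp
  have nne0 : NN (Pi.single 0 1 : Site 2) := fun i => by fin_cases i <;> simp
  have nne1 : NN (Pi.single 1 1 : Site 2) := fun i => by fin_cases i <;> simp
  have nne01 : NN ((Pi.single 0 1 : Site 2) + Pi.single 1 1) := fun i => by fin_cases i <;> simp
  -- positive representative of a letter
  have pos : ∀ s ∈ S, ∃ s' ∈ S, (s = s' ∨ s = s'⁻¹) ∧ (B.φ s' = 0 ∨ s' = B.s₀ ∨ s' = B.s₁) := by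
    intro s hs
    rcases hSφ s hs with h | rfl | rfl | rfl | rfl
    · exact ⟨s, hs, Or.inl rfl, Or.inl h⟩
    · exact ⟨B.s₀, B.s₀_mem, Or.inl rfl, Or.inr (Or.inl rfl)⟩
    · exact ⟨B.s₀, B.s₀_mem, Or.inr rfl, Or.inr (Or.inl rfl)⟩
    · exact ⟨B.s₁, B.s₁_mem, Or.inl rfl, Or.inr (Or.inr rfl)⟩
    · exact ⟨B.s₁, B.s₁_mem, Or.inr rfl, Or.inr (Or.inr rfl)⟩
  have nnpos : ∀ s' : Γ, (B.φ s' = 0 ∨ s' = B.s₀ ∨ s' = B.s₁) → NN (B.φ s') := by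
    rintro s' (h | rfl | rfl)
    · rw [h]; exact nn0
    · rw [hs0]; exact nne0
    · rw [hs1]; exact nne1
  have nnbox : ∀ v : Site 2, NN v → v ∈ box 2 1 := fun v hv => by
    rw [mem_box]; intro i; have := hv i; omega
  have nnsub : ∀ u v : Site 2, NN u → NN v → u - v ∈ box 2 1 := fun u v hu hv => by
    rw [mem_box]; intro i; have h1 := hu i; have h2 := hv i; simp only [Pi.sub_apply]; omega
  have negbox : ∀ v : Site 2, v ∈ box 2 1 → -v ∈ box 2 1 := fun v hv => by
    rw [mem_box] at hv ⊢; intro i; have := hv i; simp only [Pi.neg_apply]; omega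
  have nnsum : ∀ b' c' : Γ, b' ≠ c' → (B.φ b' = 0 ∨ b' = B.s₀ ∨ b' = B.s₁) → (B.φ c' = 0 ∨ c' = B.s₀ ∨ c' = B.s₁) →
      NN (B.φ b' + B.φ c') := by
    intro b' c' hbc hb'φ hc'φ
    rcases hb'φ with hb0 | rfl | rfl <;> rcases hc'φ with hc0 | rfl | rfl
    · rw [hb0, hc0, add_zero]; exact nn0
    · rw [hb0, zero_add, hs0]; exact nne0
    · rw [hb0, zero_add, hs1]; exact nne1
    · rw [hc0, add_zero, hs0]; exact nne0
    · exact absurd rfl hbc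
    · rw [hs0, hs1]; exact nne01
    · rw [hc0, add_zero, hs1]; exact nne1
    · rw [hs0, hs1, add_comm]; exact nne01
    · exact absurd rfl hbc
  -- the subgroup `H = closure K₁`
  set H : Subgroup Γ := Subgroup.closure B.K₁ with hH
  have hK : ∀ g ∈ B.K₁, g ∈ H := fun g hg => Subgroup.subset_closure hg
  have one_K : (1 : Γ) ∈ B.K₁ := ⟨B.φ_one, Walk.nil, fun z hz => by
    rw [support_nil, List.mem_singleton] at hz; rw [hz, B.φ_one]; exact zero_mem_box 2 1⟩
  -- (W1) all `⁅b, c⁆`, `b, c ∈ S`, lie in `H`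
  have hW1 : ∀ b ∈ S, ∀ c ∈ S, ⁅b, c⁆ ∈ H := by
    intro b hb c hc
    obtain ⟨b', hb', hbb', hb'φ⟩ := pos b hb
    obtain ⟨c', hc', hcc', hc'φ⟩ := pos c hc
    by_cases hbc : b' = c'
    · -- `b, c ∈ {b', b'⁻¹}` commute
      subst hbc
      have : ⁅b, c⁆ = 1 := by
        rcases hbb' with rfl | rfl <;> rcases hcc' with rfl | rfl <;> simp [commutatorElement_def]
      rw [this]; exact one_mem H
    · -- `φ b + φ c ∈ box 1`
      apply hK
      apply B.comm_mem_K₁ hb hc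
      have hs := nnsum b' c' hbc hb'φ hc'φ
      rcases hbb' with hb1 | hb1 <;> rcases hcc' with hc1 | hc1 <;> rw [hb1, hc1]
      · exact nnbox _ hs
      · rw [B.φ_inv, ← sub_eq_add_neg]; exact nnsub _ _ (nnpos b' hb'φ) (nnpos c' hc'φ)
      · rw [B.φ_inv, neg_add_eq_sub]; exact nnsub _ _ (nnpos c' hc'φ) (nnpos b' hb'φ)
      · rw [B.φ_inv, B.φ_inv, ← neg_add]; exact negbox _ (nnbox _ hs)
  -- (W2) all `⁅a, ⁅b, c⁆⁆` lie in `H`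
  have hγ₂ : ∀ b c : Γ, ⁅b, c⁆ ∈ (⊤ : Subgroup Γ).lowerCentralSeries 1 := fun b c => by
    rw [Subgroup.lowerCentralSeries_succ]
    exact Subgroup.commutator_mem_commutator (Subgroup.mem_top b) (Subgroup.mem_top c)
  have hW2 : ∀ a ∈ S, ∀ b ∈ S, ∀ c ∈ S, ⁅a, ⁅b, c⁆⁆ ∈ H := by
    intro a ha b hb c hc
    obtain ⟨a', ha', haa', ha'φ⟩ := pos a ha
    obtain ⟨b', hb', hbb', hb'φ⟩ := pos b hb
    obtain ⟨c', hc', hcc', hc'φ⟩ := pos c hc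
    by_cases hbc : b' = c'
    · subst hbc
      have : ⁅b, c⁆ = 1 := by
        rcases hbb' with rfl | rfl <;> rcases hcc' with rfl | rfl <;> simp [commutatorElement_def]
      rw [this, commutatorElement_one_right]; exact one_mem H
    -- the positive weight-3 commutator is in `H`
    have hnnbc : NN (B.φ b' + B.φ c') := nnsum b' c' hbc hb'φ hc'φ
    have hpos : ⁅a'⁻¹, ⁅b', c'⁆⁆ ∈ H := hK _ (B.comm₃_mem_K₁ ha' hb' hc' (nnpos a' ha'φ) (nnpos b' hb'φ) (nnpos c' hc'φ) hnnbc)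
    have hpos' : ⁅a', ⁅b', c'⁆⁆ ∈ H := by
      have := comm_inv_left h3 (hγ₂ b' c') a'
      rw [this] at hpos
      exact (inv_mem_iff (x := ⁅a', ⁅b', c'⁆⁆)).1 hpos
    -- `⁅a, t'⁆ ∈ H` for `t' = ⁅b',c'⁆^{±1}` and `a ∈ {a', a'⁻¹}`
    have haT : ⁅a, ⁅b', c'⁆⁆ ∈ H ∧ ⁅a, ⁅b', c'⁆⁻¹⁆ ∈ H := by
      have h_a : ⁅a, ⁅b', c'⁆⁆ ∈ H := by
        rcases haa' with rfl | rfl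
        · exact hpos'
        · rw [comm_inv_left h3 (hγ₂ b' c')]; exact inv_mem hpos'
      exact ⟨h_a, by rw [comm_inv_right h3 (hγ₂ b' c')]; exact inv_mem h_a⟩
    -- `⁅b, c⁆` is a conjugate of `⁅b', c'⁆^{±1}`
    have conj : ∃ g : Γ, (⁅b, c⁆ = g * ⁅b', c'⁆ * g⁻¹) ∨ (⁅b, c⁆ = g * ⁅b', c'⁆⁻¹ * g⁻¹) := by
      rcases hbb' with hb1 | hb1 <;> rcases hcc' with hc1 | hc1 <;> rw [hb1, hc1]
      · exact ⟨1, Or.inl (by group)⟩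
      · exact ⟨c'⁻¹, Or.inr (by simp only [commutatorElement_def]; group)⟩
      · exact ⟨b'⁻¹, Or.inr (by simp only [commutatorElement_def]; group)⟩
      · exact ⟨b'⁻¹ * c'⁻¹, Or.inl (by simp only [commutatorElement_def]; group)⟩
    obtain ⟨g, hg | hg⟩ := conj
    · rw [hg, comm_conj_right h3 (hγ₂ b' c')]; exact haT.1
    · rw [hg, comm_conj_right h3 ((inv_mem_iff (x := ⁅b', c'⁆)).2 (hγ₂ b' c'))]; exact haT.2
  -- every generator of the kernel criterion lies in `H`
  have hgen : ∀ g ∈ ({a | a ∈ (S : Set Γ) ∧ B.φ a = 0} ∪ KerGen.T (S : Set Γ)), g ∈ H := by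
    rintro g (⟨hgS, hg0⟩ | hgT)
    · refine hK g ⟨hg0, stepWalk (Finset.mem_coe.1 hgS) 1 |>.copy rfl (one_mul g), fun z hz => ?_⟩
      rw [support_copy] at hz
      rcases support_stepWalk (Finset.mem_coe.1 hgS) 1 hz with rfl | rfl
      · rw [B.φ_one]; exact zero_mem_box 2 1
      · rw [one_mul, hg0]; exact zero_mem_box 2 1
    · obtain ⟨n, hn⟩ := Set.mem_iUnion.1 hgT
      rcases n with _ | _ | n
      · obtain ⟨a, ha, w, hw, rfl⟩ := hn
        exact hW1 a (Finset.mem_coe.1 ha) w (Finset.mem_coe.1 hw)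
      · obtain ⟨a, ha, w, hw, rfl⟩ := hn
        obtain ⟨b, hb, c, hc, rfl⟩ := hw
        exact hW2 a (Finset.mem_coe.1 ha) b (Finset.mem_coe.1 hb) c (Finset.mem_coe.1 hc)
      · have : g = 1 := KerGen.W_eq_one_of_lowerCentralSeries_eq_bot h3 (by omega) hn
        rw [this]; exact one_mem H
  -- conclude by the kernel criterion and closure induction
  have hmem : k ∈ H := by
    have h := KerGen.mem_closure_of_eq_zero B.φ B.map_mul hS (fun a ha => Finset.mem_coe.2 (hsymm a (Finset.mem_coe.1 ha))) hs0 hs1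
      (fun a ha => hSφ a (Finset.mem_coe.1 ha)) hk
    exact (Subgroup.closure_le H).2 hgen h
  exact (B.exists_inBox_of_mem_closure 1 (T := B.K₁) (fun t ht => ht) hmem).2

end CylBase

end CayCyl

/-! ## §4 The free nilpotent groups of class three, letters only -/

namespace FreeNilThree

open FreeNilClass CayCyl

variable (m : ℕ)

/-- `φ 1 = 0` on `N_{m+2,3}`. [folklore] -/
theorem φ_one₃ : φ m 2 (1 : N m 2) = 0 := by
  have h := φ_mul (1 : N m 2) 1; rw [one_mul] at h; exact left_eq_add.1 h

/-- `φ g⁻¹ = −φ g` on `N_{m+2,3}`. [folklore] -/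
theorem φ_inv₃ (g : N m 2) : φ m 2 g⁻¹ = -φ m 2 g := by
  have h := φ_mul g⁻¹ g; rw [inv_mul_cancel, φ_one₃] at h; exact eq_neg_of_add_eq_zero_left h.symm

/-- The heights of the two axis letters. [folklore] -/
theorem φ_axes : φ m 2 (π m 2 (FreeGroup.of 0)) = Pi.single 0 1 ∧ φ m 2 (π m 2 (FreeGroup.of 1)) = Pi.single 1 1 :=
  ⟨by rw [φ_π_of]; rfl, by rw [φ_π_of]; rfl⟩

/-- The base datum of `N_{m+2,3}` with the letters `a_i^{±1}`. [folklore] -/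
def base : CylBase (N m 2) (AL m 2) where
  φ := φ m 2
  map_mul := φ_mul
  lip := fun s hs i => by
    have e := φ_axes m
    rcases AL_cases hs with h | rfl | rfl | rfl | rfl
    · rw [h]; simp
    · rw [e.1]; fin_cases i <;> simp
    · rw [φ_inv₃, e.1]; fin_cases i <;> simp
    · rw [e.2]; fin_cases i <;> simp
    · rw [φ_inv₃, e.2]; fin_cases i <;> simp
  s₀ := π m 2 (FreeGroup.of 0)
  s₀_mem := mem_AL.2 ⟨FreeGroup.of 0, mem_L.2 ⟨0, Or.inl rfl⟩, rfl⟩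
  φ_s₀ := (φ_axes m).1
  s₁ := π m 2 (FreeGroup.of 1)
  s₁_mem := mem_AL.2 ⟨FreeGroup.of 1, mem_L.2 ⟨1, Or.inl rfl⟩, rfl⟩
  φ_s₁ := (φ_axes m).2

/-- Every kernel element of `N_{m+2,3}` is joined to `1` inside the unit cylinder of the letters-only Cayley graph. [folklore] -/
theorem boxWalks (k : N m 2) (hk : φ m 2 k = 0) :
    ∃ w : (mulCayley (↑(AL m 2) : Set (N m 2))).Walk (1 : N m 2) k, (base m).InBox 1 w :=
  (base m).boxWalks_of_classThree (lowerCentralSeries_N_eq_bot m 2) closure_AL (fun _ h => inv_mem_AL h)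
    (fun s hs => by
      rcases AL_cases hs with h | h | h | h | h
      · exact Or.inl h
      · exact Or.inr (Or.inl h)
      · exact Or.inr (Or.inr (Or.inl h))
      · exact Or.inr (Or.inr (Or.inr (Or.inl h)))
      · exact Or.inr (Or.inr (Or.inr (Or.inr h)))) k hk

/-- **The `CayleySign₂` datum of `N_{m+2,3}` with letters only.** [folklore] -/
def cayleySign₂ : CayleySign₂ (N m 2) (AL m 2) where
  φ := φ m 2
  map_mul := φ_mul
  lip := (base m).lip
  step := fun i => by
    fin_cases i
    · exact ⟨(base m).s₀, (base m).s₀_mem, (base m).φ_s₀⟩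
    · exact ⟨(base m).s₁, (base m).s₁_mem, (base m).φ_s₁⟩
  ν := ν m 2
  ν_mem := sgnAut_mem_AL _
  ν_φ := φ_ν
  cyl_one := ((base m).toCylData₂ 1 (boxWalks m)).cylG_connected_of_boxWalks (boxWalks m) le_rfl
  κ := κ m 2
  κ_mem := sgnAut_mem_AL _
  κ_φ := φ_κ

/-- **THEOREM (unconditional): `θ_g(p) = 0` for every `p ≤ p_c` at every vertex of the LETTERS-ONLY Cayley graph of the free nilpotent group
`N_{m+2,3}` of class three, every rank `≥ 2`** — two sign automorphisms + connected unit cylinder (thick frames); no commutator generators added.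
builds on p205010 (kernel theorem, internal audit signed; external expert review pending).
[cite: BenjaminiSchramm1996, Conj. 4] [cite: AizenmanGrimmett1991, Thm 1] [cite: KozmaNitzan2024, §1 p. 2 (approach 1)] -/
theorem theta_eq_zero_of_le (g : N m 2) {p : unitInterval}
    (hp : (p : ℝ) ≤ criticalProb (mulCayley (↑(AL m 2) : Set (N m 2))) g) :
    theta (mulCayley (↑(AL m 2) : Set (N m 2))) g p = 0 :=
  (cayleySign₂ m).theta_eq_zero_of_le g hp

/-- **`θ_g(p_c) = 0` on the letters-only Cayley graph of `N_{m+2,3}`.**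
builds on p205010 (kernel theorem, internal audit signed; external expert review pending). [cite: BenjaminiSchramm1996, Conj. 4] -/
theorem criticalContinuity (g : N m 2) :
    theta (mulCayley (↑(AL m 2) : Set (N m 2))) g (criticalProbIOf (mulCayley (↑(AL m 2) : Set (N m 2))) g) = 0 :=
  (cayleySign₂ m).criticalContinuity₂ g

end FreeNilThree

end Summit.CriticalPhenomena.PercolationContinuityZ3.Theorems.Transplant

end
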